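import Literature.Computability.Cryptography.HallgrenClassGroupFormComposition
import HarnessLib

/-!
# Hallgren 2005 / class numbers under GRH — step Q2d (iii-a): the group of reduced forms, powers,
# and the subgroup generated by a list of forms (field-free), with its link to `Cl(𝓞_K)`

Topic `Literature/Computability/Cryptography`; proof companion of `HallgrenClassGroup.lean`
(named fact `Hallgren2005_classNumber_qsolvable_of_GRH`). Real definitions and theorems; no named
fact. Sequel of `HallgrenClassGroupFormComposition.lean` (`compose`, `[𝔞_{compose f g}] = [𝔞_f][𝔞_g]`).
The quantum sub-problem of the class-number algorithm ("the order of the subgroup of `Cl(−d)`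
generated by given reduced forms") must be stated WITHOUT choosing a quadratic field; this file
provides the field-free objects and proves, for any imaginary quadratic `K` of discriminant `D`,
that they are the class-group objects:

* `one D` (the principal form as a `BinQF`), `formPow D f e` (iterated composition),
  `GenForms D L` (the inductive closure of `one D` and the reduced forms in `L` under `compose D`)
  and **`genOrder D L = Nat.card {f // GenForms D L f}`** — the answer of the quantum sub-problem;
* `classOf b f ∈ Cl(𝓞_K)` (total version of `[𝔞_f]`), `classOf_one`, `classOf_compose`,
  `classOf_formPow`, `classOf_reduce`, **`classOf_inj`** (reduced forms with the same class are
  equal; Cox Thm. 7.7(ii) via the tree's `eq_of_properEquiv_of_isReduced`), `classOf_surjOn`;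
* **`genOrder_eq_card_closure`**: `genOrder D L = |⟨classOf f : f ∈ L⟩|` (the image of `GenForms`
  is the subgroup generated — a submonoid of a finite group is a subgroup).

## References

* D. A. Cox, *Primes of the form x² + ny²*, 2nd ed. (2013), §2.A, §3.A, §7.B Thm. 7.7 [Cox2013].
* A. M. Childs, W. van Dam, Rev. Mod. Phys. 82 (2010), §5.7 [ChildsVandam2010].
-/

noncomputable section

open scoped nonZeroDivisors

namespace Literature.Computability.Cryptography.Hallgren2005

namespace FormComposition

open Module NumberField
open Literature.NumberTheory.QuadraticFields.Quadratic Literature.NumberTheory.QuadraticFields.Quadratic.BinQF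
open Literature.NumberTheory.EllipticCurves Composition Reduction
open Literature.NumberTheory.QuadraticFields.BinaryQuadraticForm (reducedForms principalForm
  principalForm_fst principalForm_mem_reducedForms mem_reducedForms_iff isReduced_iff)

/-! ### Field-free objects -/

/-- The principal form `(1, b₀, c₀)` of discriminant `D` as a `BinQF` (the identity of the form
class group). [cite: Cox2013, §2.A (the principal form)] -/
def one (D : ℤ) : BinQF := ⟨(principalForm D).1, (principalForm D).2.1, (principalForm D).2.2⟩

/-- `(one D).a = 1`. [folklore] -/
theorem one_a (D : ℤ) : (one D).a = 1 := principalForm_fst D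

/-- The principal form is primitive positive definite of discriminant `D` and reduced (`D < 0`,
`D ≡ 0, 1 (mod 4)`). [cite: Cox2013, §2.A] -/
theorem isPosPrim_one {D : ℤ} (hD0 : D < 0) (hD4 : D % 4 = 0 ∨ D % 4 = 1) :
    (one D).IsPosPrim D ∧ (one D).IsReduced := by
  obtain ⟨hdisc, hpos, hprim, hred⟩ := (mem_reducedForms_iff hD0).1 (principalForm_mem_reducedForms hD0 hD4)
  exact ⟨⟨hdisc, hpos, hprim⟩, (isReduced_iff _ _ _).1 hred⟩

/-- **Powers of a form**: `f^0 = one`, `f^{e+1} = compose (f^e) f`. [cite: Cox2013, §3.A] -/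
def formPow (D : ℤ) (f : BinQF) : ℕ → BinQF
  | 0 => one D
  | e + 1 => compose D (formPow D f e) f

/-- **The forms generated by a list**: the closure of the principal form and the members of `L`
under composition (for reduced primitive positive definite members this is the subgroup of the
form class group generated by `L`, `genOrder_eq_card_closure`). [folklore] -/
inductive GenForms (D : ℤ) (L : List BinQF) : BinQF → Prop
  | one : GenForms D L (one D)
  | mem {f : BinQF} (h : f ∈ L) : GenForms D L f
  | mul {f g : BinQF} (hf : GenForms D L f) (hg : GenForms D L g) : GenForms D L (compose D f g)

/-- **The order of the subgroup generated by `L`** (field-free): the number of generated forms.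
[folklore] -/
def genOrder (D : ℤ) (L : List BinQF) : ℕ := Nat.card {f // GenForms D L f}

/-! ### The link to the class group of an imaginary quadratic field -/

section Ring

variable {K : Type*} [Field K] [NumberField K] (b : Basis (Fin 2) ℤ (𝓞 K)) (hb : b 0 = 1)
  (hω : b 1 * b 1 = (mOf (NumberField.discr K) : 𝓞 K) + (NumberField.discr K : 𝓞 K) * b 1)

/-- The ideal class of a form (total version: `1` when `a ≤ 0`). [cite: Cox2013, §7.B Thm. 7.7] -/
def classOf (f : BinQF) : ClassGroup (𝓞 K) :=
  if h : 0 < f.a then ClassGroup.mk0 ⟨formIdeal b f, formIdeal_mem_nonZeroDivisors b hb h⟩ else 1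

include hb in
/-- `classOf f = [𝔞_f]` for `a > 0`. [folklore] -/
theorem classOf_eq {f : BinQF} (h : 0 < f.a) :
    classOf b hb f = ClassGroup.mk0 ⟨formIdeal b f, formIdeal_mem_nonZeroDivisors b hb h⟩ :=
  dif_pos h

/-- The principal form has the trivial class. [cite: Cox2013, §7.B Thm. 7.7] -/
theorem classOf_one' {D : ℤ} : classOf b hb (one D) = 1 := by
  have ha : 0 < (one D).a := by rw [one_a]; exact one_pos
  rw [classOf_eq b hb ha, ClassGroup.mk0_eq_one_iff]
  have htop : formIdeal b (one D) = ⊤ := by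
    rw [formIdeal, Ideal.eq_top_iff_one]
    refine Ideal.subset_span (Set.mem_insert_iff.2 (Or.inl ?_))
    rw [one_a]; simp
  simp only [htop]
  exact ⟨⟨1, by simp⟩⟩

include hω in
/-- **Composition multiplies classes.** [cite: Cox2013, §7.B Thm. 7.7 and §3.A] -/
theorem classOf_compose (hK : IsImaginaryQuadratic K) {f g : BinQF}
    (hf : f.IsPosPrim (NumberField.discr K)) (hg : g.IsPosPrim (NumberField.discr K)) :
    classOf b hb (compose (NumberField.discr K) f g) = classOf b hb f * classOf b hb g := by
  rw [classOf_eq b hb hf.a_pos, classOf_eq b hb hg.a_pos,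
    classOf_eq b hb (isPosPrim_compose b hb hω hK hf hg).a_pos]
  exact mk0_formIdeal_compose b hb hω hK hf hg

include hω in
/-- Properly equivalent forms have the same class. [cite: Cox2013, §7.B Thm. 7.7 (proof, (7.8))] -/
theorem classOf_eq_of_properEquiv (hK : IsImaginaryQuadratic K) {f g : BinQF}
    (hf : f.IsPosPrim (NumberField.discr K)) (h : f.ProperEquiv g) : classOf b hb f = classOf b hb g := by
  rw [classOf_eq b hb hf.a_pos, classOf_eq b hb (h.isPosPrim hK.discr_neg hf).a_pos]
  exact mk0_formIdeal_eq_of_properEquiv b hb hω hK hf h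

include hω in
/-- `classOf (reduce f) = classOf f`. [folklore] -/
theorem classOf_reduce (hK : IsImaginaryQuadratic K) {f : BinQF} (hf : f.IsPosPrim (NumberField.discr K)) :
    classOf b hb (reduce f) = classOf b hb f :=
  (classOf_eq_of_properEquiv b hb hω hK hf (properEquiv_reduce f)).symm

include hω in
/-- Powers: `formPow f e` is primitive positive definite and reduced, of class `[f]^e`.
[cite: Cox2013, §3.A] -/
theorem formPow_spec (hK : IsImaginaryQuadratic K) {f : BinQF} (hf : f.IsPosPrim (NumberField.discr K)) :
    ∀ e : ℕ, (formPow (NumberField.discr K) f e).IsPosPrim (NumberField.discr K) ∧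
      (formPow (NumberField.discr K) f e).IsReduced ∧
      classOf b hb (formPow (NumberField.discr K) f e) = classOf b hb f ^ e
  | 0 => by
    obtain ⟨h1, h2⟩ := isPosPrim_one hK.discr_neg hf.emod_four
    exact ⟨h1, h2, by rw [pow_zero]; exact classOf_one' b hb⟩
  | e + 1 => by
    obtain ⟨h1, -, h3⟩ := formPow_spec hK hf e
    refine ⟨isPosPrim_compose b hb hω hK h1 hf, isReduced_compose b hb hω hK h1 hf, ?_⟩
    show classOf b hb (compose _ (formPow _ f e) f) = _
    rw [classOf_compose b hb hω hK h1 hf, h3, pow_succ]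

include hω in
/-- **Reduced forms with the same class are equal** (Cox Thm. 7.7(ii): `[𝔞_f] = [𝔞_g]` gives
`x 𝔞_f = y 𝔞_g`, hence `Γ₀(1)`-equivalent Heegner points, hence `f ∼ g`, and reduced forms in one
proper class coincide). [cite: Cox2013, §7.B Thm. 7.7(ii) and §2.A Thm. 2.8] -/
theorem classOf_inj (hK : IsImaginaryQuadratic K) {f g : BinQF} (hf : f.IsPosPrim (NumberField.discr K))
    (hg : g.IsPosPrim (NumberField.discr K)) (hfr : f.IsReduced) (hgr : g.IsReduced)
    (h : classOf b hb f = classOf b hb g) : f = g := by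
  set D := NumberField.discr K with hD
  have hD0 : D < 0 := hK.discr_neg
  have hD4 : D % 4 = 0 ∨ D % 4 = 1 := hf.emod_four
  rw [classOf_eq b hb hf.a_pos, classOf_eq b hb hg.a_pos] at h
  obtain ⟨x, y, hx, -, hxy⟩ := ClassGroup.mk0_eq_mk0_iff.mp h
  have hneg : D ^ 2 + 4 * mOf D < 0 := by rw [sq_add_four_mul_mOf hD4]; exact hD0
  have hQ : (f.a, f.b, f.c) ∈ heegnerForms 1 (D ^ 2 + 4 * mOf D) := by
    rw [sq_add_four_mul_mOf hD4]
    exact ⟨hf.disc_eq, hf.a_pos, one_dvd _, (BinQF.isPrimitive_iff f).1 hf.primitive⟩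
  have hQ' : (g.a, g.b, g.c) ∈ heegnerForms 1 (D ^ 2 + 4 * mOf D) := by
    rw [sq_add_four_mul_mOf hD4]
    exact ⟨hg.disc_eq, hg.a_pos, one_dvd _, (BinQF.isPrimitive_iff g).1 hg.primitive⟩
  have hBB' : f.b ≡ g.b [ZMOD 2 * (1 : ℕ)] := by
    have h1 := two_mul_kOf hf.disc_eq
    have h2 := two_mul_kOf hg.disc_eq
    exact (Int.modEq_iff_dvd.2 ⟨kOf D g - kOf D f, by push_cast; linarith⟩)
  have hγ := isGamma0Equiv_of_span_mul_formIdeal_eq b hb hω hneg hQ hQ' hBB' hx hxy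
  have hdisc : f.disc < 0 := by rw [hf.disc_eq]; exact hD0
  have hpe := properEquiv_of_isGamma0Equiv_one (Q := (f.a, f.b, f.c)) (Q' := (g.a, g.b, g.c)) hf.a_pos
    hdisc hg.a_pos (by show g.disc = f.disc; rw [hf.disc_eq, hg.disc_eq]) hγ
  exact BinQF.eq_of_properEquiv_of_isReduced hf hg hfr hgr hpe

include hω in
/-- **Every class is the class of a reduced form** (Cox Thm. 7.7(ii), surjectivity; tree
`reducedForms_mk0_bijective`). [cite: Cox2013, §7.B Thm. 7.7(ii)] -/
theorem exists_classOf_eq (hK : IsImaginaryQuadratic K) (c : ClassGroup (𝓞 K)) :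
    ∃ f : BinQF, f.IsPosPrim (NumberField.discr K) ∧ f.IsReduced ∧ classOf b hb f = c := by
  set D := NumberField.discr K with hD
  have hD0 : D < 0 := hK.discr_neg
  have hD4 : D % 4 = 0 ∨ D % 4 = 1 := discr_emod_four hK.finrank_eq_two
  have hneg : D ^ 2 + 4 * mOf D < 0 := by rw [sq_add_four_mul_mOf hD4]; exact hD0
  obtain ⟨⟨Q, hQ⟩, hQc⟩ := (reducedForms_mk0_bijective b hb hω hneg).2 c
  rw [sq_add_four_mul_mOf hD4] at hQ
  obtain ⟨hdisc, hpos, hprim, hred⟩ := (mem_reducedForms_iff hD0).1 hQ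
  refine ⟨⟨Q.1, Q.2.1, Q.2.2⟩, ⟨hdisc, hpos, hprim⟩, (isReduced_iff _ _ _).1 hred, ?_⟩
  rw [classOf_eq b hb hpos, ← hQc]
  rfl

/-! ### The generated forms are the generated subgroup -/

include hω in
/-- Generated forms are reduced primitive positive definite, with class in the closure.
[folklore] -/
theorem genForms_spec (hK : IsImaginaryQuadratic K) {L : List BinQF}
    (hL : ∀ f ∈ L, f.IsPosPrim (NumberField.discr K) ∧ f.IsReduced) {f : BinQF}
    (hf : GenForms (NumberField.discr K) L f) :
    f.IsPosPrim (NumberField.discr K) ∧ f.IsReduced ∧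
      classOf b hb f ∈ Subgroup.closure ((classOf b hb) '' {g | g ∈ L}) := by
  induction hf with
  | one =>
    obtain ⟨h1, h2⟩ := isPosPrim_one hK.discr_neg (discr_emod_four hK.finrank_eq_two)
    exact ⟨h1, h2, by rw [classOf_one']; exact one_mem _⟩
  | mem h => exact ⟨(hL _ h).1, (hL _ h).2, Subgroup.subset_closure ⟨_, h, rfl⟩⟩
  | mul _ _ ihf ihg =>
    exact ⟨isPosPrim_compose b hb hω hK ihf.1 ihg.1, isReduced_compose b hb hω hK ihf.1 ihg.1,
      by rw [classOf_compose b hb hω hK ihf.1 ihg.1]; exact mul_mem ihf.2.2 ihg.2.2⟩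

include hω in
/-- Every class in the closure is the class of a generated form (a submonoid of a finite group is a
subgroup: inverses are powers). [folklore] -/
theorem exists_genForms_of_mem_closure (hK : IsImaginaryQuadratic K) {L : List BinQF}
    (hL : ∀ f ∈ L, f.IsPosPrim (NumberField.discr K) ∧ f.IsReduced) {c : ClassGroup (𝓞 K)}
    (hc : c ∈ Subgroup.closure ((classOf b hb) '' {g | g ∈ L})) :
    ∃ f : BinQF, GenForms (NumberField.discr K) L f ∧ classOf b hb f = c := by
  set D := NumberField.discr K with hD
  -- powers of generated forms are generated
  have hpow : ∀ {f : BinQF}, GenForms D L f → ∀ n : ℕ, ∃ g, GenForms D L g ∧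
      classOf b hb g = classOf b hb f ^ n := by
    intro f hf n
    induction n with
    | zero => exact ⟨one D, GenForms.one, by rw [pow_zero, classOf_one']⟩
    | succ n ih =>
      obtain ⟨g, hg, hgc⟩ := ih
      have hgs := genForms_spec b hb hω hK hL hg
      have hfs := genForms_spec b hb hω hK hL hf
      exact ⟨compose D g f, GenForms.mul hg hf, by rw [classOf_compose b hb hω hK hgs.1 hfs.1, hgc, pow_succ]⟩
  induction hc using Subgroup.closure_induction with
  | mem x hx =>
    obtain ⟨g, hg, rfl⟩ := hx
    exact ⟨g, GenForms.mem hg, rfl⟩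
  | one => exact ⟨one D, GenForms.one, classOf_one' b hb⟩
  | mul x y _ _ hx hy =>
    obtain ⟨f, hf, rfl⟩ := hx
    obtain ⟨g, hg, rfl⟩ := hy
    have hfs := genForms_spec b hb hω hK hL hf
    have hgs := genForms_spec b hb hω hK hL hg
    exact ⟨compose D f g, GenForms.mul hf hg, classOf_compose b hb hω hK hfs.1 hgs.1⟩
  | inv x _ hx =>
    obtain ⟨f, hf, rfl⟩ := hx
    -- `x⁻¹ = x^(orderOf x - 1)`
    have hord := pow_orderOf_eq_one (classOf b hb f)
    have ho : 0 < orderOf (classOf b hb f) := orderOf_pos _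
    obtain ⟨g, hg, hgc⟩ := hpow hf (orderOf (classOf b hb f) - 1)
    refine ⟨g, hg, ?_⟩
    rw [hgc]
    refine eq_inv_of_mul_eq_one_left ?_
    rw [← pow_succ, Nat.sub_add_cancel ho, hord]

include hω in
/-- **`genOrder D L` is the order of the subgroup of `Cl(𝓞_K)` generated by the classes of `L`**
(for reduced primitive positive definite members). [cite: Cox2013, §7.B Thm. 7.7(ii)] -/
theorem genOrder_eq_card_closure (hK : IsImaginaryQuadratic K) {L : List BinQF}
    (hL : ∀ f ∈ L, f.IsPosPrim (NumberField.discr K) ∧ f.IsReduced) :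
    genOrder (NumberField.discr K) L =
      Nat.card (Subgroup.closure ((classOf b hb) '' {g | g ∈ L})) := by
  rw [genOrder]
  refine Nat.card_congr (Equiv.ofBijective
    (fun f => ⟨classOf b hb f.1, (genForms_spec b hb hω hK hL f.2).2.2⟩) ⟨?_, ?_⟩)
  · rintro ⟨f, hf⟩ ⟨g, hg⟩ h
    have hfs := genForms_spec b hb hω hK hL hf
    have hgs := genForms_spec b hb hω hK hL hg
    exact Subtype.ext (classOf_inj b hb hω hK hfs.1 hgs.1 hfs.2.1 hgs.2.1 (congrArg Subtype.val h))
  · rintro ⟨c, hc⟩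
    obtain ⟨f, hf, hfc⟩ := exists_genForms_of_mem_closure b hb hω hK hL hc
    exact ⟨⟨f, hf⟩, Subtype.ext hfc⟩

include hb hω in
/-- `genOrder` is at most the class number, and positive. [folklore] -/
theorem genOrder_le_classNumber (hK : IsImaginaryQuadratic K) {L : List BinQF}
    (hL : ∀ f ∈ L, f.IsPosPrim (NumberField.discr K) ∧ f.IsReduced) :
    0 < genOrder (NumberField.discr K) L ∧ genOrder (NumberField.discr K) L ≤ NumberField.classNumber K := by
  classical
  rw [genOrder_eq_card_closure b hb hω hK hL, NumberField.classNumber, ← Nat.card_eq_fintype_card]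
  exact ⟨Nat.card_pos, Subgroup.card_le_card_group _⟩

end Ring

end FormComposition

end Literature.Computability.Cryptography.Hallgren2005

end
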